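import Literature.AlgebraicGeometry.Motives.MumfordTateGroupOfOrientationMultiplier
import Literature.AlgebraicGeometry.Motives.HodgeGroupOfOrientationMinusIdentityCyclicSextic
import Literature.AlgebraicGeometry.Motives.HodgeGroupOfOrientationNondegenerate
import Literature.AlgebraicGeometry.Motives.ZarhinHodgeGroupAutC
import HarnessLib

/-!
# Orientations of K3 type (`|Π^{n,0}| = 1`, `Π^{p,q} = ∅` for `0 < p < n`, `p ≠ n/2`) are STRONGLY NONDEGENERATE:
# `M_φ(V^n_{(F,Π)}) = U_F` (Zarhin's theorem for CM Hodge structures of K3 type, in Green–Griffiths–Kerr's language) and `−id ∈ M_φ`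

[topic AlgebraicGeometry/Motives]

Layer `Literature/AlgebraicGeometry/Motives`, lane `lit-hodgefound` (Track 2 foundations library; seat `lit-hodgefound-p02`, gen 29, row g29-#7).
THEOREMS ONLY (no definition, no named fact; D-0026 net debt `0`).  The positive counterpart of the g29-#3 / g29-#6 sign-defect witness.  An `n`-orientation
`Π` of a CM field `F` is **of K3 type** when ONE embedding `θ₀` has degree `n` and every embedding other than `θ₀, θ̄₀` has degree `n/2` (so `n = 2k` is even,
`h^{n,0} = h^{0,n} = 1`, `h^{k,k} = [F:ℚ] − 2`, all other `h^{p,q} = 0`: the Hodge numbers of the transcendental lattice of a complex projective K3 surface with CM by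
`F`, `n = 2`).  Zarhin proved that the Hodge group of an irreducible Hodge structure of K3 type with (CM) endomorphism field `E` is the full unitary group
`U_E(φ)`; for `dim_E T = 1` this is the unitary torus `U_E = {e ∈ E^× | e ē = 1}`.  Here, for the SCMpHS `V^n_{(F,Π)}` of an orientation of K3 type:
(§2) **every orientation-balanced integer vector is conjugation-symmetric** — the balance condition at an automorphism `τ` of `ℂ` moving `σ` to `θ₀` (`Aut(ℂ)` is
transitive on `Hom(F,ℂ)`, the tree's `exists_ringEquiv_complex_comp_eq`) reads `n·(c_σ − c_σ̄) = 0`; hence (§3) `(F,Π)` is STRONGLY NONDEGENERATE (g26-#2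
`isStronglyNondegenerate_iff_forall_conjugate_symm`, (V.D.6) on characters), so (§4) **`M_φ(V^n_{(F,Π)})(ℂ) = U_F(ℂ) = {u | u_σ u_σ̄ = 1}`** (Zarhin's theorem in
GGK's language, via g26-#2 `mem_hodgeGroupBaseChange_complex_ofOrientation_iff_of_isStronglyNondegenerate`), **`−id ∈ M_φ`** (every balanced mass is even; g29-#1),
and `M_φ = Ker ν` inside `M_φ̃` for every polarization (g29-#2).

THE PRINTS.  Yu. G. Zarhin [Zarhin1983HodgeGroupsK3] Thm. 2.2.1 (`E` CM: `Hdg_T = U_E(φ)`), §2; D. Huybrechts [Huybrechts2016K3] Thm. 3.3.9 and Rem. 3.3.14 (iii)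
(CM case: `Hdg(T) = Res_{K/ℚ} U(1)`-type torus); M. Green, P. Griffiths, M. Kerr [GreenGriffithsKerr2012] (V.A.7) p0157 («`(F,Π)` is non-degenerate if
`𝓡(F,Π) = ½[F″:ℚ] + 1`»), (V.D.6) p0165 («nondegeneracy … means that Mumford–Tate is cut out by rational 1- and 2-tensors»).  (READING NOTE, proved: the
orientation-level special case `dim_F V = 1`; nothing about K3 surfaces themselves.)

WHAT IS PROVED (`K` a CM field, `Λ : Orientation K n`, `hn : n ≠ 0`, `θ₀` with `deg θ₀ = n`, `hΛ : ∀ θ ∉ {θ₀, θ̄₀}, 2·deg θ = n`).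
* §1 `exists_ringEquiv_smul_eq` (`Aut(ℂ)` is transitive on `Hom(K,ℂ)` for a number field `K`), `two_mul_deg_smul_eq` (the degree table seen from `τ` with `τ•σ = θ₀`).
* §2 **`conjugate_symm_of_balanced_of_k3Type`**, `even_sum_of_balanced_of_k3Type`, `hodgeNumber_top_eq_one_of_k3Type` (`h^{n,0} = 1`), `hodgeClasses_eq_bot_of_k3Type`
  (no rational `(k,k)`-classes when `[K:ℚ] > 2`… stated as: `Hdgᵏ = 0`, since `deg θ̄₀ = 0 < k`).
* §3 **`isStronglyNondegenerate_of_k3Type`** (`j : K →ₐ[ℚ] L`, `ι : L → ℂ`, `L/ℚ` normal).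
* §4 **`mem_hodgeGroupBaseChange_complex_ofOrientation_iff_of_k3Type`** (`M_φ(ℂ) = U_F(ℂ)`), `mem_mumfordTateGroupBaseChange_complex_ofOrientation_iff_of_k3Type`
  (`M_φ̃(ℂ)`: `u_σ u_σ̄` a non-zero constant), **`smulOfUnit_neg_one_mem_hodgeGroupBaseChange_complex_of_k3Type`** / `…real…` / `smulOfUnit_neg_one_mem_hodgeGroup_of_k3Type`,
  `mem_hodgeGroupBaseChange_complex_ofOrientation_iff_multiplierChar_eq_one_of_k3Type` (`M_φ = Ker ν`).

HONEST SCOPE.  (1) «K3 type» is the hypothesis on the degree function displayed above (any even `n ≠ 0`); no lattice, surface or geometric Hodge structure enters.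
(2) §3–§4 `M_φ = U_F` are stated, as everywhere in the tree, relative to auxiliary `(L, j, ι)` (`L/ℚ` normal containing `j(K)`); `−id ∈ M_φ` (§4) needs none.
(3) Zarhin's theorem for `dim_E T > 1` (`U_E(φ)`, `SO_E(φ)` for `E` totally real) is the tree's `Motives/ZarhinHodgeGroup*`, not this file.

## References
* [Zarhin1983HodgeGroupsK3] Yu. G. Zarhin, *Hodge groups of K3 surfaces*, J. reine angew. Math. 341 (1983) — Thm. 2.2.1, §2.
* [Huybrechts2016K3] D. Huybrechts, *Lectures on K3 Surfaces* (2016) — Thm. 3.3.9, Rem. 3.3.14 (iii).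
* [GreenGriffithsKerr2012] M. Green, P. Griffiths, M. Kerr, *Mumford–Tate Groups and Domains* (2012) — (V.A.7) p. 157, (V.D.6) p. 165, §I.B p. 35.
* [Moonen2004MT] B. Moonen, *An introduction to Mumford–Tate groups* (2004) — (5.8).

## Provenance
Lane `lit-hodgefound` (Hodge path, Track 2), prover seat `lit-hodgefound-p02` (generation 29), self-proposed row g29-#7.
-/

noncomputable section

open scoped TensorProduct Classical
open Module NumberField

namespace Literature.AlgebraicGeometry.Motives

namespace HodgeStructure

open RealMult (embCoords embCoords_tmul)
open Orientation Literature.NumberTheory.ComplexMultiplication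

/-! ### §1 `Aut(ℂ)` is transitive on `Hom(K,ℂ)`; the degree table from a moving frame -/

section Transitive

variable {K : Type} [Field K] [NumberField K]

/-- **`Aut(ℂ)` acts transitively on the complex embeddings of a number field** (the tree's `exists_ringEquiv_complex_comp_eq` for countable fields, in the
`•`-notation of `EmbeddingAction`). [cite: Zarhin1983HodgeGroupsK3, §2] -/
theorem exists_ringEquiv_smul_eq (σ₀ σ : K →+* ℂ) : ∃ τ : ℂ ≃+* ℂ, τ • σ₀ = σ := by
  haveI : Countable K := Countable.of_equiv _ (Module.finBasis ℚ K).equivFun.toEquiv.symm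
  obtain ⟨τ, hτ⟩ := ZarhinLie.exists_ringEquiv_complex_comp_eq σ₀ σ
  exact ⟨τ, RingHom.ext fun x => by rw [ringEquiv_smul_apply, hτ]⟩

variable [IsCMField K] {n : ℤ} (Λ : Orientation K n)

/-- **The degree table of a K3-type orientation seen through `τ` with `τ•σ = θ₀`**: `2·deg(τ•σ') = n + n·[σ' = σ] − n·[σ' = σ̄]`.
[cite: GreenGriffithsKerr2012, §V.A p. 154 («`Π̄^{p,q} = Π^{q,p}`»)] -/
theorem two_mul_deg_smul_eq_of_k3Type {θ₀ : K →+* ℂ} (h0 : Λ.deg θ₀ = n)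
    (hΛ : ∀ θ : K →+* ℂ, θ ≠ θ₀ → θ ≠ ComplexEmbedding.conjugate θ₀ → 2 * Λ.deg θ = n) {τ : ℂ ≃+* ℂ} {σ : K →+* ℂ} (hτ : τ • σ = θ₀)
    (σ' : K →+* ℂ) :
    2 * Λ.deg (τ • σ') = n + (if σ' = σ then n else 0) - (if σ' = ComplexEmbedding.conjugate σ then n else 0) := by
  have hσσ : σ ≠ ComplexEmbedding.conjugate σ := fun hσ =>
    IsTotallyComplex.complexEmbedding_not_isReal σ (ComplexEmbedding.isReal_iff.2 hσ.symm)
  by_cases h1 : σ' = σ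
  · subst h1
    rw [if_pos rfl, if_neg hσσ, hτ, h0]
    ring
  · rw [if_neg h1]
    by_cases h2 : σ' = ComplexEmbedding.conjugate σ
    · subst h2
      rw [if_pos rfl, smul_conjugate_eq_conjugate_smul, hτ, Λ.deg_conjugate, h0]
      ring
    · rw [if_neg h2]
      have h3 : τ • σ' ≠ θ₀ := fun h => h1 (MulAction.injective τ (h.trans hτ.symm))
      have h4 : τ • σ' ≠ ComplexEmbedding.conjugate θ₀ := fun h =>
        h2 (MulAction.injective τ (show τ • σ' = τ • ComplexEmbedding.conjugate σ by
          rw [h, smul_conjugate_eq_conjugate_smul, hτ]))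
      rw [hΛ _ h3 h4]
      ring

end Transitive

/-! ### §2 Balanced vectors of a K3-type orientation are conjugation-symmetric, of even mass -/

section K3Type

variable {K : Type} [Field K] [NumberField K] [IsCMField K] {n : ℤ} (Λ : Orientation K n) (hn : n ≠ 0) {θ₀ : K →+* ℂ} (h0 : Λ.deg θ₀ = n)
  (hΛ : ∀ θ : K →+* ℂ, θ ≠ θ₀ → θ ≠ ComplexEmbedding.conjugate θ₀ → 2 * Λ.deg θ = n)

include hn h0 hΛ

/-- **Every orientation-balanced integer vector of a K3-type orientation is conjugation-symmetric**: balance at `τ` with `τ•σ = θ₀` is `n Σc + n c_σ − n c_σ̄ = n Σc`.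
So no character of `Res_{F/ℚ}𝔾_m` beyond the divisor-type (symmetric) ones kills `M_φ`. [cite: Zarhin1983HodgeGroupsK3, Thm. 2.2.1] [cite: GreenGriffithsKerr2012, (V.D.6) p. 165] -/
theorem conjugate_symm_of_balanced_of_k3Type (c : (K →+* ℂ) → ℤ) (hc : ∀ τ : ℂ ≃+* ℂ, 2 * ∑ σ, c σ * Λ.deg (τ • σ) = n * ∑ σ, c σ)
    (σ : K →+* ℂ) : c (ComplexEmbedding.conjugate σ) = c σ := by
  obtain ⟨τ, hτ⟩ := exists_ringEquiv_smul_eq σ θ₀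
  have h1 := hc τ
  have h2 : 2 * ∑ σ', c σ' * Λ.deg (τ • σ') = ∑ σ', c σ' * (2 * Λ.deg (τ • σ')) := by
    rw [Finset.mul_sum]
    exact Finset.sum_congr rfl fun σ' _ => by ring
  rw [h2] at h1
  simp only [two_mul_deg_smul_eq_of_k3Type Λ h0 hΛ hτ, mul_sub, mul_add, mul_ite, mul_zero, Finset.sum_sub_distrib,
    Finset.sum_add_distrib, Finset.sum_ite_eq', Finset.mem_univ, if_true, ← Finset.sum_mul] at h1
  have h3 : (c σ - c (ComplexEmbedding.conjugate σ)) * n = 0 := by linarith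
  rcases mul_eq_zero.1 h3 with h | h
  · exact (sub_eq_zero.1 h).symm
  · exact absurd h hn

/-- **… hence of EVEN mass** (`Σ_σ c_σ = Σ_{t ∈ Φ} 2c_t` for any CM type `Φ`). [cite: Zarhin1983HodgeGroupsK3, Thm. 2.2.1] [cite: GreenGriffithsKerr2012, §I.B p. 35] -/
theorem even_sum_of_balanced_of_k3Type (c : (K →+* ℂ) → ℤ) (hc : ∀ τ : ℂ ≃+* ℂ, 2 * ∑ σ, c σ * Λ.deg (τ • σ) = n * ∑ σ, c σ) :
    Even (∑ σ, c σ) := by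
  obtain ⟨Φ⟩ := (CMTypeCount.nonempty_cmType_iff_isTotallyComplex (K := K)).2 inferInstance
  rw [sum_eq_sum_cmType_add_conjugate Φ c]
  refine Finset.even_sum _ fun t _ => ?_
  rw [conjugate_symm_of_balanced_of_k3Type Λ hn h0 hΛ c hc]
  exact ⟨c (t : K →+* ℂ), rfl⟩

omit [IsCMField K] hΛ in
/-- **`h^{n,0}(V^n_{(F,Π)}) = 1`**: `Π^{n,0} = {θ₀}` (`deg θ̄₀ = 0 ≠ n`, and `2·deg θ = n ≠ 2n` elsewhere). [cite: Huybrechts2016K3, §3.3.3] [cite: GreenGriffithsKerr2012, §V.C p. 161] -/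
theorem hodgeNumber_top_eq_one_of_k3Type (hΛ : ∀ θ : K →+* ℂ, θ ≠ θ₀ → θ ≠ ComplexEmbedding.conjugate θ₀ → 2 * Λ.deg θ = n) :
    (ofOrientation Λ).hodgeNumber n (n - n) = 1 := by
  rw [hodgeNumber_ofOrientation]
  have h1 : Λ.typeSet n = {θ₀} := by
    ext θ
    rw [Orientation.mem_typeSet_iff, Set.mem_singleton_iff]
    constructor
    · intro hθ
      by_contra hne
      by_cases h2 : θ = ComplexEmbedding.conjugate θ₀
      · rw [h2, Λ.deg_conjugate, h0, sub_self] at hθ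
        exact hn hθ.symm
      · have h3 := hΛ θ hne h2
        rw [hθ] at h3
        exact hn (by omega)
    · rintro rfl
      exact h0
  rw [h1, Set.ncard_singleton]

omit [IsCMField K] hΛ in
/-- **`Hdg^{n/2}(V^n_{(F,Π)}) = 0`**: no non-zero rational `(k,k)`-class (`deg θ̄₀ = 0 < k` for `n = 2k > 0`, resp. `deg θ₀ = n < k` for `n < 0`); by g28's
`mem_hodgeClasses_ofOrientation_iff`. [cite: GreenGriffithsKerr2012, §V Warning p. 154] [cite: Huybrechts2016K3, §3.3.3] -/
theorem hodgeClasses_eq_bot_of_k3Type {k : ℤ} (hk : n = 2 * k) : (ofOrientation Λ).hodgeClasses k = ⊥ := by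
  rw [hodgeClasses_ofOrientation_eq_bot_iff]
  rcases lt_or_gt_of_ne hn with h | h
  · exact ⟨θ₀, by rw [h0]; omega⟩
  · refine ⟨ComplexEmbedding.conjugate θ₀, ?_⟩
    rw [Λ.deg_conjugate, h0]
    omega

end K3Type

/-! ### §3 Strong nondegeneracy -/

section Nondegenerate

variable {K : Type} [Field K] [NumberField K] [IsCMField K] {n : ℤ} (Λ : Orientation K n) (hn : n ≠ 0) {θ₀ : K →+* ℂ} (h0 : Λ.deg θ₀ = n)
  (hΛ : ∀ θ : K →+* ℂ, θ ≠ θ₀ → θ ≠ ComplexEmbedding.conjugate θ₀ → 2 * Λ.deg θ = n)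
  {L : Type} [Field L] [NumberField L] [Normal ℚ L]

include hn h0 hΛ

/-- **An orientation of K3 type is STRONGLY NONDEGENERATE**: `𝓡(F,Π) = ½[F:ℚ] + 1` ((V.D.6) on characters, g26-#2 `isStronglyNondegenerate_iff_forall_conjugate_symm`, and §2).
[cite: GreenGriffithsKerr2012, (V.A.7) p. 157 and (V.D.6) p. 165] [cite: Zarhin1983HodgeGroupsK3, Thm. 2.2.1] -/
theorem isStronglyNondegenerate_of_k3Type (j : K →ₐ[ℚ] L) (ι : L →+* ℂ) : Λ.IsStronglyNondegenerate j ι :=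
  (isStronglyNondegenerate_iff_forall_conjugate_symm Λ j ι hn).2 fun c hc σ => conjugate_symm_of_balanced_of_k3Type Λ hn h0 hΛ c hc σ

variable [HodgeTensorFacts.{0, 0}]

/-- **ZARHIN'S THEOREM FOR `V^n_{(F,Π)}` OF K3 TYPE: `M_φ(ℂ) = U_F(ℂ)`** — a `ℂ`-point of `GL(V_ℂ)` lies in the Hodge group iff it is multiplication by a unit
`u ∈ (ℂ ⊗ F)^×` with `u_σ u_σ̄ = 1` for all `σ` (g26-#2 `mem_hodgeGroupBaseChange_complex_ofOrientation_iff_of_isStronglyNondegenerate`).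
[cite: Zarhin1983HodgeGroupsK3, Thm. 2.2.1] [cite: Huybrechts2016K3, Thm. 3.3.9 and Rem. 3.3.14 (iii)] [cite: GreenGriffithsKerr2012, (V.D.6) p. 165] -/
theorem mem_hodgeGroupBaseChange_complex_ofOrientation_iff_of_k3Type (j : K →ₐ[ℚ] L) (ι : L →+* ℂ) (γ : (ℂ ⊗[ℚ] K) ≃ₗ[ℂ] (ℂ ⊗[ℚ] K)) :
    γ ∈ (ofOrientation Λ).hodgeGroupBaseChange ℂ ↔
      (∀ x, γ x = x * γ 1) ∧ ∀ σ, embCoords K (γ 1) σ * embCoords K (γ 1) (ComplexEmbedding.conjugate σ) = 1 :=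
  mem_hodgeGroupBaseChange_complex_ofOrientation_iff_of_isStronglyNondegenerate Λ j ι hn (isStronglyNondegenerate_of_k3Type Λ hn h0 hΛ j ι) γ

/-- **`M_φ̃(ℂ) = {u | u_σ u_σ̄ = c ≠ 0 constant}`** for K3 type (g26-#2 `mem_mumfordTateGroupBaseChange_complex_ofOrientation_iff_of_isStronglyNondegenerate`).
[cite: Zarhin1983HodgeGroupsK3, §2] [cite: GreenGriffithsKerr2012, (V.D.6) p. 165] -/
theorem mem_mumfordTateGroupBaseChange_complex_ofOrientation_iff_of_k3Type (j : K →ₐ[ℚ] L) (ι : L →+* ℂ) (γ : (ℂ ⊗[ℚ] K) ≃ₗ[ℂ] (ℂ ⊗[ℚ] K)) :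
    γ ∈ (ofOrientation Λ).mumfordTateGroupBaseChange ℂ ↔
      (∀ x, γ x = x * γ 1) ∧
        ∃ c : ℂ, c ≠ 0 ∧ ∀ σ, embCoords K (γ 1) σ * embCoords K (γ 1) (ComplexEmbedding.conjugate σ) = c :=
  mem_mumfordTateGroupBaseChange_complex_ofOrientation_iff_of_isStronglyNondegenerate Λ j ι hn (isStronglyNondegenerate_of_k3Type Λ hn h0 hΛ j ι) γ

end Nondegenerate

/-! ### §4 `−id ∈ M_φ` and `M_φ = Ker ν` for K3 type (no auxiliary Galois closure needed) -/

section MinusIdentity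

variable {K : Type} [Field K] [NumberField K] [IsCMField K] {n : ℤ} (Λ : Orientation K n) (hn : n ≠ 0) {θ₀ : K →+* ℂ} (h0 : Λ.deg θ₀ = n)
  (hΛ : ∀ θ : K →+* ℂ, θ ≠ θ₀ → θ ≠ ComplexEmbedding.conjugate θ₀ → 2 * Λ.deg θ = n) [HodgeTensorFacts.{0, 0}]

include hn h0 hΛ

/-- **`−id ∈ M_φ(V^n_{(F,Π)})(ℂ)` for K3 type** (g29-#1: iff every balanced mass is even; §2). [cite: Zarhin1983HodgeGroupsK3, Thm. 2.2.1] [cite: GreenGriffithsKerr2012, §I.B p. 35] -/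
theorem smulOfUnit_neg_one_mem_hodgeGroupBaseChange_complex_of_k3Type :
    (LinearEquiv.smulOfUnit (-1 : ℂˣ) : (ℂ ⊗[ℚ] K) ≃ₗ[ℂ] (ℂ ⊗[ℚ] K)) ∈ (ofOrientation Λ).hodgeGroupBaseChange ℂ :=
  (smulOfUnit_neg_one_mem_hodgeGroupBaseChange_complex_ofOrientation_iff Λ).2 fun m hm => even_sum_of_balanced_of_k3Type Λ hn h0 hΛ m hm

/-- `−id ∈ M_φ(ℝ)` for K3 type. [cite: Zarhin1983HodgeGroupsK3, Thm. 2.2.1] [cite: GreenGriffithsKerr2012, §I.B p. 35] -/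
theorem smulOfUnit_neg_one_mem_hodgeGroupBaseChange_real_of_k3Type :
    (LinearEquiv.smulOfUnit (-1 : ℝˣ) : (ℝ ⊗[ℚ] K) ≃ₗ[ℝ] (ℝ ⊗[ℚ] K)) ∈ (ofOrientation Λ).hodgeGroupBaseChange ℝ :=
  (smulOfUnit_neg_one_mem_hodgeGroupBaseChange_real_ofOrientation_iff Λ).2 fun m hm => even_sum_of_balanced_of_k3Type Λ hn h0 hΛ m hm

/-- `−id ∈ M_φ(ℚ)` for K3 type. [cite: Zarhin1983HodgeGroupsK3, Thm. 2.2.1] [cite: GreenGriffithsKerr2012, §I.B p. 35] -/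
theorem smulOfUnit_neg_one_mem_hodgeGroup_of_k3Type :
    (LinearEquiv.smulOfUnit (-1 : ℚˣ) : K ≃ₗ[ℚ] K) ∈ (ofOrientation Λ).hodgeGroup :=
  (smulOfUnit_neg_one_mem_hodgeGroup_ofOrientation_iff Λ).2 fun m hm => even_sum_of_balanced_of_k3Type Λ hn h0 hΛ m hm

/-- **`M_φ = Ker ν` inside `M_φ̃` for K3 type** (`ℂ`-points; g29-#2 `mem_hodgeGroupBaseChange_complex_ofOrientation_iff_multiplierChar_eq_one_of_smulOfUnit_neg_one_mem`): Moonen's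
«`Hg = Ker(MT → 𝔾_m)`» holds for these even-weight CM Hodge structures. [cite: Moonen2004MT, (5.8)] [cite: Zarhin1983HodgeGroupsK3, Thm. 2.2.1] -/
theorem mem_hodgeGroupBaseChange_complex_ofOrientation_iff_multiplierChar_eq_one_of_k3Type (ψ : (ofOrientation Λ).Polarization)
    {γ : (ℂ ⊗[ℚ] K) ≃ₗ[ℂ] (ℂ ⊗[ℚ] K)} (hγ : γ ∈ (ofOrientation Λ).mumfordTateGroupBaseChange ℂ) :
    γ ∈ (ofOrientation Λ).hodgeGroupBaseChange ℂ ↔ ψ.multiplierChar ℂ ⟨γ, hγ⟩ = 1 :=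
  mem_hodgeGroupBaseChange_complex_ofOrientation_iff_multiplierChar_eq_one_of_smulOfUnit_neg_one_mem Λ
    (smulOfUnit_neg_one_mem_hodgeGroupBaseChange_complex_of_k3Type Λ hn h0 hΛ) ψ hγ

end MinusIdentity

end HodgeStructure

end Literature.AlgebraicGeometry.Motives

end
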